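import Literature.AlgebraicGeometry.Resolution.AffineDomainDimension
import Literature.RingTheory.MvPolynomial.Directrix
import Literature.RingTheory.MvPolynomial.VariableIdeals
import Mathlib.Algebra.MvPolynomial.Expand
import Mathlib.RingTheory.KrullDimension.Polynomial
import Mathlib.RingTheory.KrullDimension.Field
import HarnessLib

/-!
# Mizutani's conjecture — the dimension of a subgroup scheme of `𝔾_a^m` cut out by `p`-polynomials of one degree

Cell topic `Summits/ResolutionOfSingularities/KangarooAtlas` (pub-rosobs); namespace
`Summit.ResolutionOfSingularities.KangarooAtlas.Mizutani`.  Part of the Lean transcription of the in-house note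
MIZUTANI-PROOF-g59 (AI-written, AI-audited; *AI review is weaker than expert review*; NOT a resolution theorem, NOT
summit progress).  General commutative algebra behind Oda's sentence "the dimension of `B(𝔭)` equals the rank of
`L/L_B` as a module over `k[F]`" (Publ. RIMS 19 (1983) p. 1168; Mizutani 1973 Thm. 1.3), which the vocabulary file
`Literature/…/HironakaGroupScheme.lean` takes as the DEFINITION `hsDimAt`:

**`ringKrullDim (k[X_0, …, X_{m−1}] ⧸ (Σ_j a_j X_j^q : a ∈ N)) = m − dim_k N`** (`ringKrullDim_quotient_span_powForm`)
for every field `k`, every `q ≥ 1` and every subspace `N ≤ k^m` of coefficient vectors.  Ingredients: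

* `rootPart q` — the `k`-linear retraction `X^β ↦ X^{β/q}` (if `q ∣ β`, else `0`) of the Frobenius-type expansion
  `expand q : X_i ↦ X_i^q`, with `rootPart q (expand q t * s) = t * rootPart q s`; hence
  `comap_map_expand : (J.map (expand q)).comap (expand q) = J` for EVERY ideal `J`;
* `ringKrullDim_quotient_map_expand` — `k[X] ⧸ J.map (expand q)` is an injective integral extension of `k[X] ⧸ J`,
  so the two quotients have the same Krull dimension (`ringKrullDim_eq_of_isIntegral`);
* `ringKrullDim_quotient_span_linForm` — for LINEAR forms, `dim k[X] ⧸ (Σ a_j X_j : a ∈ N) = m − dim N` (a basis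
  of `k^m` adapted to `N`, the tree's `coordChangeEquiv`, and `k[X] ⧸ (X_j : j ∈ J) ≅ k[X_j : j ∉ J]`);
* `span_powForm_eq_map` — `(Σ a_j X_j^q : a ∈ N) = (Σ a_j X_j : a ∈ N).map (expand q)`.

References: [Oda1983HironakaGroupSchemeII] §2 (p. 1168); [Mizutani1973HironakaGroupSchemes] Thm. 1.3; [Matsumura1987] Thm. 9.4
(dimension and integral extensions), Thm. 5.6.
-/

open MvPolynomial Literature.RingTheory.MvPolynomial

namespace Summit.ResolutionOfSingularities.KangarooAtlas.Mizutani

universe u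

variable {k : Type u} [Field k] {m : ℕ}

/-! ## The retraction of `expand q` -/

section RootPart

variable (k m) (q : ℕ)

open Classical in
/-- **The `q`-th root part** of a polynomial: the `k`-linear map `X^β ↦ X^{β/q}` if `q ∣ β_i` for all `i`, and
`X^β ↦ 0` otherwise (a retraction of `expand q`, linear over `k[X]` acting through `expand q`). [folklore] -/
noncomputable def rootPart : MvPolynomial (Fin m) k →ₗ[k] MvPolynomial (Fin m) k :=
  (MvPolynomial.basisMonomials (Fin m) k).constr k fun β =>
    if ∀ i, q ∣ β i then monomial (β.mapRange (· / q) (Nat.zero_div q)) (1 : k) else 0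

variable {k m q}

open Classical in
/-- `rootPart` on a monomial. [folklore] -/
theorem rootPart_monomial (β : Fin m →₀ ℕ) (a : k) :
    rootPart k m q (monomial β a) =
      if ∀ i, q ∣ β i then monomial (β.mapRange (· / q) (Nat.zero_div q)) a else 0 := by
  have hb : monomial β a = a • (MvPolynomial.basisMonomials (Fin m) k) β := by
    rw [MvPolynomial.coe_basisMonomials, smul_monomial, smul_eq_mul, mul_one]
  rw [hb, LinearMap.map_smul, rootPart, Module.Basis.constr_basis]
  split_ifs with h
  · rw [smul_monomial, smul_eq_mul, mul_one]
  · rw [smul_zero]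

/-- **The coefficients of the root part**: `coeff γ (rootPart q f) = coeff (q • γ) f` (`q ≠ 0`). [folklore] -/
theorem coeff_rootPart (hq : q ≠ 0) (f : MvPolynomial (Fin m) k) (γ : Fin m →₀ ℕ) :
    coeff γ (rootPart k m q f) = coeff (q • γ) f := by
  classical
  induction f using MvPolynomial.induction_on' with
  | monomial β a =>
    rw [rootPart_monomial, coeff_monomial]
    by_cases hβ : β = q • γ
    · subst hβ
      have hdvd : ∀ i, q ∣ (q • γ) i := fun i => ⟨γ i, by rw [Finsupp.smul_apply, smul_eq_mul]⟩
      have hdiv : (q • γ).mapRange (· / q) (Nat.zero_div q) = γ := by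
        ext i
        rw [Finsupp.mapRange_apply, Finsupp.smul_apply, smul_eq_mul, Nat.mul_div_cancel_left _ (Nat.pos_of_ne_zero hq)]
      rw [if_pos hdvd, hdiv, coeff_monomial, if_pos rfl, if_pos rfl]
    · rw [if_neg hβ]
      split_ifs with hdvd
      · rw [coeff_monomial, if_neg]
        intro hγ
        apply hβ
        ext i
        have hi := congrArg (fun δ : Fin m →₀ ℕ => δ i) hγ
        simp only [Finsupp.mapRange_apply] at hi
        rw [Finsupp.smul_apply, smul_eq_mul, ← hi, Nat.mul_div_cancel' (hdvd i)]
      · rw [coeff_zero]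
  | add f g hf hg => rw [map_add, coeff_add, coeff_add, hf, hg]

/-- `q • α ≤ q • γ ↔ α ≤ γ` for exponent vectors (`q ≠ 0`). [folklore] -/
theorem smul_le_smul_iff_of_ne_zero (hq : q ≠ 0) {α γ : Fin m →₀ ℕ} : q • α ≤ q • γ ↔ α ≤ γ := by
  constructor
  · intro h i
    have := h i
    rw [Finsupp.smul_apply, Finsupp.smul_apply, smul_eq_mul, smul_eq_mul] at this
    exact Nat.le_of_mul_le_mul_left this (Nat.pos_of_ne_zero hq)
  · intro h i
    rw [Finsupp.smul_apply, Finsupp.smul_apply, smul_eq_mul, smul_eq_mul]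
    exact Nat.mul_le_mul_left q (h i)

omit [Field k] in
/-- `q • γ − q • α = q • (γ − α)` for exponent vectors. [folklore] -/
theorem smul_tsub_smul (q : ℕ) (α γ : Fin m →₀ ℕ) : q • γ - q • α = q • (γ - α) := by
  ext i
  simp only [Finsupp.coe_tsub, Pi.sub_apply, Finsupp.smul_apply, smul_eq_mul]
  rw [Nat.mul_sub]

/-- **`rootPart` is linear over `k[X]` acting through `expand q`**: `rootPart (expand q t * s) = t * rootPart s`.
[folklore] -/
theorem rootPart_expand_mul (hq : q ≠ 0) (t s : MvPolynomial (Fin m) k) :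
    rootPart k m q (expand q t * s) = t * rootPart k m q s := by
  classical
  induction t using MvPolynomial.induction_on' with
  | monomial α a =>
    ext γ
    rw [expand_monomial, coeff_rootPart hq, coeff_monomial_mul', coeff_monomial_mul', coeff_rootPart hq,
      smul_tsub_smul]
    simp only [smul_le_smul_iff_of_ne_zero hq]
  | add t₁ t₂ h₁ h₂ => rw [map_add, add_mul, map_add, h₁, h₂, add_mul]

/-- `rootPart (expand q t) = t`: a retraction. [folklore] -/
theorem rootPart_expand (hq : q ≠ 0) (t : MvPolynomial (Fin m) k) : rootPart k m q (expand q t) = t := by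
  have h := rootPart_expand_mul hq t 1
  have h1 : rootPart k m q (1 : MvPolynomial (Fin m) k) = 1 := by
    rw [show (1 : MvPolynomial (Fin m) k) = monomial 0 1 from rfl, rootPart_monomial, if_pos fun i => by
      simp only [Finsupp.coe_zero, Pi.zero_apply]; exact dvd_zero q]
    rw [Finsupp.mapRange_zero]
  rw [mul_one, h1, mul_one] at h
  exact h

/-- **Extension–contraction along `expand q` is the identity on ideals**: `(J.map (expand q)).comap (expand q) = J`
for every ideal `J` (`q ≠ 0`), by the retraction `rootPart`. [folklore] -/
theorem comap_map_expand (hq : q ≠ 0) (J : Ideal (MvPolynomial (Fin m) k)) :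
    (J.map (expand q : MvPolynomial (Fin m) k →ₐ[k] MvPolynomial (Fin m) k)).comap
      (expand q : MvPolynomial (Fin m) k →ₐ[k] MvPolynomial (Fin m) k) = J := by
  refine le_antisymm ?_ Ideal.le_comap_map
  intro t ht
  rw [Ideal.mem_comap] at ht
  -- every element `g` of the extended ideal has `rootPart (g * s) ∈ J` for all `s`
  have key : ∀ g ∈ J.map (expand q : MvPolynomial (Fin m) k →ₐ[k] MvPolynomial (Fin m) k),
      ∀ s, rootPart k m q (g * s) ∈ J := by
    intro g hg
    rw [Ideal.map] at hg
    refine Submodule.span_induction ?_ ?_ ?_ ?_ hg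
    · rintro _ ⟨j, hj, rfl⟩ s
      rw [rootPart_expand_mul hq]
      exact Ideal.mul_mem_right _ _ hj
    · intro s
      rw [zero_mul, map_zero]
      exact J.zero_mem
    · intro g₁ g₂ _ _ h₁ h₂ s
      rw [add_mul, map_add]
      exact J.add_mem (h₁ s) (h₂ s)
    · intro r g _ hg s
      rw [smul_eq_mul, mul_assoc, mul_left_comm]
      exact hg (r * s)
  have := key _ ht 1
  rwa [mul_one, rootPart_expand hq] at this

end RootPart

/-! ## `expand q` preserves the Krull dimension of quotients -/

section Krull

variable {q : ℕ}

/-- **`dim k[X] ⧸ J.map (X ↦ X^q) = dim k[X] ⧸ J`**: along `expand q` the quotient `k[X] ⧸ J.map (expand q)` is an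
injective (`comap_map_expand`) integral (`x_i^q = expand q (X_i)`) extension of `k[X] ⧸ J`, and Krull dimension is
invariant under injective integral extensions. [cite: Matsumura1987, Thm. 9.4 (with Ex. 9.2)] -/
theorem ringKrullDim_quotient_map_expand (hq : q ≠ 0) (J : Ideal (MvPolynomial (Fin m) k)) :
    ringKrullDim (MvPolynomial (Fin m) k ⧸
        J.map (expand q : MvPolynomial (Fin m) k →ₐ[k] MvPolynomial (Fin m) k)) =
      ringKrullDim (MvPolynomial (Fin m) k ⧸ J) := by
  set φ : MvPolynomial (Fin m) k →ₐ[k] MvPolynomial (Fin m) k := expand q with hφ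
  set J' : Ideal (MvPolynomial (Fin m) k) := J.map φ with hJ'
  have hle : J ≤ J'.comap (φ : MvPolynomial (Fin m) k →+* MvPolynomial (Fin m) k) := fun x hx =>
    Ideal.mem_comap.mpr (Ideal.mem_map_of_mem φ hx)
  set θ : MvPolynomial (Fin m) k ⧸ J →+* MvPolynomial (Fin m) k ⧸ J' :=
    Ideal.quotientMap J' (φ : MvPolynomial (Fin m) k →+* MvPolynomial (Fin m) k) hle with hθ
  have hθmk : ∀ f, θ (Ideal.Quotient.mk J f) = Ideal.Quotient.mk J' (expand q f) := fun f => by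
    rw [hθ, Ideal.quotientMap_mk]
    rfl
  have hcomap : J'.comap (φ : MvPolynomial (Fin m) k →+* MvPolynomial (Fin m) k) ≤ J := fun x hx => by
    have hx' : φ x ∈ J' := Ideal.mem_comap.mp hx
    have : x ∈ (J.map φ).comap φ := Ideal.mem_comap.mpr hx'
    rwa [hφ, comap_map_expand hq J] at this
  have hinj : Function.Injective θ := Ideal.quotientMap_injective' hcomap
  letI : Algebra (MvPolynomial (Fin m) k ⧸ J) (MvPolynomial (Fin m) k ⧸ J') := θ.toAlgebra
  have halg : ∀ y, algebraMap (MvPolynomial (Fin m) k ⧸ J) (MvPolynomial (Fin m) k ⧸ J') y = θ y := fun _ => rfl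
  -- integrality: the classes of the `X_i` satisfy `Y^q − [X_i] = 0`, and they generate
  have hint : ∀ f : MvPolynomial (Fin m) k,
      IsIntegral (MvPolynomial (Fin m) k ⧸ J) (Ideal.Quotient.mk J' f) := by
    intro f
    induction f using MvPolynomial.induction_on with
    | C a =>
      have : Ideal.Quotient.mk J' (C a) =
          algebraMap (MvPolynomial (Fin m) k ⧸ J) (MvPolynomial (Fin m) k ⧸ J') (Ideal.Quotient.mk J (C a)) := by
        rw [halg, hθmk, expand_C]
      rw [this]
      exact isIntegral_algebraMap
    | add f g hf hg => rw [map_add]; exact hf.add hg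
    | mul_X f i hf =>
      rw [map_mul]
      refine hf.mul ?_
      refine ⟨Polynomial.X ^ q - Polynomial.C (Ideal.Quotient.mk J (X i)),
        Polynomial.monic_X_pow_sub_C _ hq, ?_⟩
      rw [Polynomial.eval₂_sub, Polynomial.eval₂_X_pow, Polynomial.eval₂_C, halg, hθmk, expand_X, map_pow,
        sub_self]
  haveI : Algebra.IsIntegral (MvPolynomial (Fin m) k ⧸ J) (MvPolynomial (Fin m) k ⧸ J') :=
    ⟨fun y => by
      obtain ⟨f, rfl⟩ := Ideal.Quotient.mk_surjective y
      exact hint f⟩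
  exact Literature.AlgebraicGeometry.Resolution.ringKrullDim_eq_of_isIntegral hinj

end Krull

/-! ## Linear forms: `dim k[X] ⧸ (Σ a_j X_j : a ∈ N) = m − dim N` -/

section Linear

/-- The IDEAL generated by the images of a `k`-linear map on a subspace is generated by the images of any
spanning set. [folklore] -/
theorem ideal_span_image_span (L : (Fin m → k) →ₗ[k] MvPolynomial (Fin m) k) (S : Set (Fin m → k)) :
    Ideal.span (L '' (Submodule.span k S : Set (Fin m → k))) = Ideal.span (L '' S) := by
  refine le_antisymm ?_ (Ideal.span_mono (Set.image_mono Submodule.subset_span))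
  rw [Ideal.span_le]
  rintro _ ⟨v, hv, rfl⟩
  refine Submodule.span_induction ?_ ?_ ?_ ?_ hv
  · intro w hw
    exact Ideal.subset_span ⟨w, hw, rfl⟩
  · rw [map_zero]; exact Ideal.zero_mem _
  · intro w₁ w₂ _ _ h₁ h₂
    rw [map_add]; exact Ideal.add_mem _ h₁ h₂
  · intro c w _ hw
    rw [map_smul, MvPolynomial.smul_eq_C_mul]
    exact Ideal.mul_mem_left _ _ hw

/-- Killing the variables of `J`: `k[X_0..X_{m−1}] → k[X_i : i ∉ J]`. [folklore] -/
noncomputable def killFin (J : Finset (Fin m)) : MvPolynomial (Fin m) k →ₐ[k] MvPolynomial {i : Fin m // i ∉ J} k :=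
  aeval fun i => if h : i ∈ J then 0 else X ⟨i, h⟩

/-- `killFin J` is surjective (`rename Subtype.val` is a section). [folklore] -/
theorem killFin_surjective (J : Finset (Fin m)) : Function.Surjective (killFin (k := k) J) := by
  intro g
  refine ⟨rename (Subtype.val : {i : Fin m // i ∉ J} → Fin m) g, ?_⟩
  have hcomp : (killFin (k := k) J).comp (rename (Subtype.val : {i : Fin m // i ∉ J} → Fin m)) = AlgHom.id k _ := by
    refine MvPolynomial.algHom_ext fun i => ?_
    rw [AlgHom.comp_apply, rename_X, killFin, aeval_X, dif_neg i.2, AlgHom.id_apply]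
  exact congrArg (fun ψ : MvPolynomial {i : Fin m // i ∉ J} k →ₐ[k] MvPolynomial {i : Fin m // i ∉ J} k => ψ g) hcomp

/-- The kernel of `killFin J` is `(X_j : j ∈ J)`. [folklore] -/
theorem ker_killFin (J : Finset (Fin m)) :
    RingHom.ker (killFin (k := k) J) = Ideal.span (X '' (↑J : Set (Fin m))) := by
  classical
  have hcomp : (rename (Subtype.val : {i : Fin m // i ∉ J} → Fin m)).comp (killFin (k := k) J) =
      aeval (fun i => if i ∈ (↑J : Set (Fin m)) then (0 : MvPolynomial (Fin m) k) else X i) := by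
    refine MvPolynomial.algHom_ext fun i => ?_
    by_cases hi : i ∈ J
    · rw [AlgHom.comp_apply, killFin, aeval_X, dif_pos hi, map_zero, aeval_X, if_pos (Finset.mem_coe.mpr hi)]
    · rw [AlgHom.comp_apply, killFin, aeval_X, dif_neg hi, rename_X, aeval_X,
        if_neg (fun h => hi (Finset.mem_coe.mp h))]
  rw [← ker_aeval_ite_eq_span (↑J : Set (Fin m)), ← hcomp]
  ext f
  rw [RingHom.mem_ker, RingHom.mem_ker, AlgHom.comp_apply,
    map_eq_zero_iff _ (rename_injective _ Subtype.val_injective)]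

/-- `k[X] ⧸ (X_j : j ∈ J) ≅ k[X_i : i ∉ J]`. [folklore] -/
noncomputable def quotientSpanXEquiv (J : Finset (Fin m)) :
    (MvPolynomial (Fin m) k ⧸ (Ideal.span (X '' (↑J : Set (Fin m))) : Ideal (MvPolynomial (Fin m) k))) ≃ₐ[k]
      MvPolynomial {i : Fin m // i ∉ J} k :=
  (Ideal.quotientEquivAlgOfEq k (ker_killFin J).symm).trans
    (Ideal.quotientKerAlgEquivOfSurjective (killFin_surjective J))

/-- `dim k[X_0..X_{m−1}] ⧸ (X_j : j ∈ J) = m − |J|`. [cite: Matsumura1987, Thm. 5.6 (dim k[X_1..X_n] = n)] -/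
theorem ringKrullDim_quotient_span_X (J : Finset (Fin m)) :
    ringKrullDim (MvPolynomial (Fin m) k ⧸ (Ideal.span (X '' (↑J : Set (Fin m))) : Ideal (MvPolynomial (Fin m) k))) =
      ((m - J.card : ℕ) : WithBot ℕ∞) := by
  classical
  rw [ringKrullDim_eq_of_ringEquiv (quotientSpanXEquiv J).toRingEquiv,
    MvPolynomial.ringKrullDim_of_isNoetherianRing, ringKrullDim_eq_zero_of_field, zero_add]
  congr 1
  rw [Nat.card_eq_fintype_card, Fintype.card_subtype_compl, Fintype.card_fin, Fintype.card_coe]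

/-- **`dim k[X_0..X_{m−1}] ⧸ (Σ_j a_j X_j : a ∈ N) = m − dim_k N`** for every subspace `N ≤ k^m` of coefficient
vectors (change coordinates by a basis of `k^m` adapted to `N`). [cite: Matsumura1987, Thm. 5.6] -/
theorem ringKrullDim_quotient_span_linForm (N : Submodule k (Fin m → k)) :
    ringKrullDim (MvPolynomial (Fin m) k ⧸ Ideal.span (linForm '' (N : Set (Fin m → k)))) =
      ((m - Module.finrank k N : ℕ) : WithBot ℕ∞) := by
  classical
  obtain ⟨b, J, J₂, hJ, _hJ₂⟩ := exists_basis_adapted N ⊥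
  -- the ideal is generated by the `linForm (b j)`, `j ∈ J`
  have hspan : Ideal.span (linForm '' (N : Set (Fin m → k))) =
      Ideal.span (linForm '' (b '' (↑J : Set (Fin m)))) := by
    rw [← hJ, ideal_span_image_span]
  -- move them to the variables `X_j`, `j ∈ J`
  set θ := coordChangeEquiv b with hθ
  have hmap : (Ideal.span (X '' (↑J : Set (Fin m))) : Ideal (MvPolynomial (Fin m) k)) =
      (Ideal.span (linForm '' (N : Set (Fin m → k)))).map
        (θ.toRingEquiv : MvPolynomial (Fin m) k →+* MvPolynomial (Fin m) k) := by
    rw [hspan, Ideal.map_span]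
    congr 1
    ext f
    constructor
    · rintro ⟨j, hj, rfl⟩
      refine ⟨linForm (b j), ⟨b j, ⟨j, hj, rfl⟩, rfl⟩, ?_⟩
      exact coordChangeEquiv_linForm_basis b j
    · rintro ⟨_, ⟨_, ⟨j, hj, rfl⟩, rfl⟩, rfl⟩
      exact ⟨j, hj, (coordChangeEquiv_linForm_basis b j).symm⟩
  rw [ringKrullDim_eq_of_ringEquiv (Ideal.quotientEquiv _ _ θ.toRingEquiv hmap), ringKrullDim_quotient_span_X]
  -- `dim N = |J|`
  have hli : LinearIndependent k (fun j : J => b j) := b.linearIndependent.comp _ Subtype.val_injective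
  have hrange : Set.range (fun j : J => b j) = b '' (↑J : Set (Fin m)) := by
    ext v
    constructor
    · rintro ⟨⟨j, hj⟩, rfl⟩
      exact ⟨j, hj, rfl⟩
    · rintro ⟨j, hj, rfl⟩
      exact ⟨⟨j, hj⟩, rfl⟩
  have hcard : Module.finrank k N = J.card := by
    rw [← hJ, ← hrange, finrank_span_eq_card hli, Fintype.card_coe]
  rw [hcard]

end Linear

/-! ## Power forms: `dim k[X] ⧸ (Σ a_j X_j^q : a ∈ N) = m − dim N` -/

section Pow

variable (q : ℕ)

/-- The `q`-POWER FORM `Σ_j a_j X_j^q` with coefficient vector `a` (for `q = p^e` in characteristic `p`: the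
additive form `addForm` of `HironakaGroupScheme.lean`). [cite: Oda1983HironakaGroupSchemeII, §2 (p. 1167: L_e)] -/
noncomputable def powForm (a : Fin m → k) : MvPolynomial (Fin m) k := ∑ j, C (a j) * X j ^ q

/-- `expand q (Σ a_j X_j) = Σ a_j X_j^q`. [folklore] -/
theorem expand_linForm (a : Fin m → k) : expand q (linForm a) = powForm q a := by
  rw [linForm_apply, map_sum, powForm]
  refine Finset.sum_congr rfl fun j _ => ?_
  rw [map_smul, expand_X, MvPolynomial.smul_eq_C_mul]

/-- `(Σ a_j X_j^q : a ∈ S) = (Σ a_j X_j : a ∈ S).map (expand q)`. [folklore] -/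
theorem span_powForm_eq_map (S : Set (Fin m → k)) :
    Ideal.span (powForm q '' S) =
      (Ideal.span (linForm '' S)).map (expand q : MvPolynomial (Fin m) k →ₐ[k] MvPolynomial (Fin m) k) := by
  rw [Ideal.map_span, Set.image_image]
  congr 1
  refine Set.image_congr' fun a => ?_
  exact (expand_linForm q a).symm

/-- **`dim k[X_0..X_{m−1}] ⧸ (Σ_j a_j X_j^q : a ∈ N) = m − dim_k N`** for every field `k`, every `q ≥ 1` and every
subspace `N ≤ k^m` — the subgroup scheme of `𝔾_a^m` cut out by the `p`-polynomials of one degree `q = p^e` with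
coefficient vectors in `N` has dimension `m − dim N` (Oda: "the dimension of `B(𝔭)` equals the rank of `L/L_B`").
[cite: Oda1983HironakaGroupSchemeII, §2 (p. 1168); Mizutani1973HironakaGroupSchemes, Thm. 1.3] -/
theorem ringKrullDim_quotient_span_powForm (hq : q ≠ 0) (N : Submodule k (Fin m → k)) :
    ringKrullDim (MvPolynomial (Fin m) k ⧸ Ideal.span (powForm q '' (N : Set (Fin m → k)))) =
      ((m - Module.finrank k N : ℕ) : WithBot ℕ∞) := by
  rw [span_powForm_eq_map, ringKrullDim_quotient_map_expand hq, ringKrullDim_quotient_span_linForm]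

end Pow

end Summit.ResolutionOfSingularities.KangarooAtlas.Mizutani
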